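import Mathlib
import HarnessLib

/-!
# Crux `FiniteSusceptibilityWeakCoupling` (stmt-QuantumFields-9442), line `purity-rate-split` —
# stub `stub_oddTraceActionBound`: on `SU(N)` the `C`-odd character `Im tr V` is `O((N - Re tr V)^{3/2})`

Skeleton line `purity-rate-split` of the crux
`Summit.QuantumFields.YangMills.Theses.FradkinShenkerFlow.FiniteSusceptibilityWeakCoupling` splits the
weak-coupling finite-susceptibility input of 4-d lattice Yang–Mills for a compact simple gauge group into a
purity half and a rate half. The rate half fails for `U(1)` in `d = 4` because the `C`-odd plaquette
observable `Im tr U_p = sin θ_p` couples *linearly* to the massless photon. For `SU(N)`-valued plaquettes this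
failure mode is absent, and the registered stub proved here is the single-plaquette inequality behind that:

* `stub_oddTraceActionBound` — for every `N` there is `C` such that every special unitary `V ∈ SU(N)`
  satisfies `|Im tr V| ≤ C · (N - Re tr V) ^ (3/2)`: the `C`-odd character is controlled *super-linearly*
  by the Wilson action density.

Proof. The roots `μ₁, …, μ_N` of the characteristic polynomial of `V` (with multiplicity) lie in the spectrum
of the unitary `V`, hence on the unit circle; their sum is `tr V` and their product is `det V = 1`. Writing
`μ_j = exp (i θ_j)` with `θ_j = arg μ_j ∈ (-π, π]` gives `Im tr V = ∑ sin θ_j`,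
`N - Re tr V = g := ∑ (1 - cos θ_j) ≥ 0` and `∑ θ_j = 2πk` for an integer `k`. With `n := N`,
`t := 1/(n+1)` and `δ := 1 - cos t > 0`: if `g ≥ δ` then `|∑ sin θ_j| ≤ n ≤ (n / δ^{3/2}) g^{3/2}`; if
`g < δ` then every `1 - cos θ_j < 1 - cos t` forces `|θ_j| < t`, so `|2πk| = |∑ θ_j| < n t < 1` and `k = 0`,
whence `∑ sin θ_j = ∑ (sin θ_j - θ_j)`, `|sin θ_j - θ_j| ≤ |θ_j|³ ≤ √(8g) · θ_j²` and
`θ_j² ≤ (π²/2)(1 - cos θ_j) ≤ 8 (1 - cos θ_j)`, giving `|∑ sin θ_j| ≤ 8 √8 · g^{3/2}`. The constant is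
`C = N / δ^{3/2} + 8 √8`.

Helper lemmas live in the sub-namespace `OddTraceActionBound`. Mathlib only; no named unproved facts are used.
-/

set_option autoImplicit false

open scoped Real Matrix.Norms.L2Operator

namespace Summit.QuantumFields.YangMills.Theorems.FiniteSusceptibilityWeakCoupling

namespace OddTraceActionBound

/-! ### Elementary real estimates -/

/-- Quadratic lower bound for the action density of one angle: `x² ≤ 8 (1 - cos x)` for `|x| ≤ π`
(from `cos x ≤ 1 - (2/π²) x²` and `π² ≤ 16`). [folklore] -/
theorem sq_le_eight_mul_one_sub_cos {x : ℝ} (hx : |x| ≤ π) : x ^ 2 ≤ 8 * (1 - Real.cos x) := by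
  have h1 : Real.cos x ≤ 1 - 2 / π ^ 2 * x ^ 2 := Real.cos_le_one_sub_mul_cos_sq hx
  have h4 : (1 : ℝ) ≤ 16 / π ^ 2 := by
    rw [le_div_iff₀ (by positivity), one_mul]
    nlinarith [Real.pi_le_four, Real.pi_pos]
  calc x ^ 2 = x ^ 2 * 1 := (mul_one _).symm
    _ ≤ x ^ 2 * (16 / π ^ 2) := mul_le_mul_of_nonneg_left h4 (sq_nonneg x)
    _ = 8 * (2 / π ^ 2 * x ^ 2) := by ring
    _ ≤ 8 * (1 - Real.cos x) := by linarith

/-- Cubic Taylor remainder of the sine: `|sin x - x| ≤ |x|³`. [folklore] -/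
theorem abs_sin_sub_self_le (x : ℝ) : |Real.sin x - x| ≤ |x| ^ 3 := by
  rw [abs_sub_comm]
  have h := Real.abs_sub_sin_le x
  have h0 : 0 ≤ |x| ^ 3 := by positivity
  linarith

/-- `g ^ (3/2) = g · √g` for `g ≥ 0`. [folklore] -/
theorem rpow_three_halves {g : ℝ} (hg : 0 ≤ g) : g ^ ((3 : ℝ) / 2) = g * √g := by
  have h : (3 : ℝ) / 2 = 1 + 1 / 2 := by norm_num
  rw [h, Real.rpow_add' hg (by norm_num), Real.rpow_one, Real.sqrt_eq_rpow]

variable {ι : Type*} [Fintype ι]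

/-- The total action density `∑ (1 - cos θ_i)` is non-negative. [folklore] -/
theorem sum_one_sub_cos_nonneg (θ : ι → ℝ) : 0 ≤ ∑ i, (1 - Real.cos (θ i)) :=
  Finset.sum_nonneg fun _ _ => sub_nonneg.2 (Real.cos_le_one _)

/-- Each term of the action density is bounded by the total. [folklore] -/
theorem one_sub_cos_le_sum (θ : ι → ℝ) (i : ι) :
    1 - Real.cos (θ i) ≤ ∑ j, (1 - Real.cos (θ j)) :=
  Finset.single_le_sum (f := fun j => 1 - Real.cos (θ j))
    (fun _ _ => sub_nonneg.2 (Real.cos_le_one _)) (Finset.mem_univ i)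

/-- Trivial bound `|∑ sin θ_i| ≤ #ι`. [folklore] -/
theorem abs_sum_sin_le_card (θ : ι → ℝ) : |∑ i, Real.sin (θ i)| ≤ Fintype.card ι :=
  calc |∑ i, Real.sin (θ i)| ≤ ∑ i, |Real.sin (θ i)| := Finset.abs_sum_le_sum_abs _ _
    _ ≤ ∑ _i : ι, (1 : ℝ) := Finset.sum_le_sum fun i _ => Real.abs_sin_le_one _
    _ = Fintype.card ι := by rw [Finset.sum_const, Finset.card_univ, nsmul_eq_mul, mul_one]

/-- **Zero-sum case.** If `|θ_i| ≤ π` and `∑ θ_i = 0` then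
`|∑ sin θ_i| ≤ 8 √8 · g √g` with `g = ∑ (1 - cos θ_i)`: indeed `∑ sin θ_i = ∑ (sin θ_i - θ_i)`,
`|sin θ_i - θ_i| ≤ |θ_i|³ = |θ_i| θ_i²`, `|θ_i| ≤ √(8 g)` and `θ_i² ≤ 8 (1 - cos θ_i)`. [folklore] -/
theorem abs_sum_sin_le_of_sum_eq_zero (θ : ι → ℝ) (hθ : ∀ i, |θ i| ≤ π) (hsum : ∑ i, θ i = 0) :
    |∑ i, Real.sin (θ i)| ≤
      8 * √8 * ((∑ i, (1 - Real.cos (θ i))) * √(∑ i, (1 - Real.cos (θ i)))) := by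
  set g : ℝ := ∑ i, (1 - Real.cos (θ i))
  have hterm : ∀ i, θ i ^ 2 ≤ 8 * (1 - Real.cos (θ i)) := fun i =>
    sq_le_eight_mul_one_sub_cos (hθ i)
  have habs : ∀ i, |θ i| ≤ √(8 * g) := fun i =>
    Real.abs_le_sqrt ((hterm i).trans
      (mul_le_mul_of_nonneg_left (one_sub_cos_le_sum θ i) (by norm_num)))
  calc |∑ i, Real.sin (θ i)| = |∑ i, (Real.sin (θ i) - θ i)| := by
        rw [Finset.sum_sub_distrib, hsum, sub_zero]
    _ ≤ ∑ i, |Real.sin (θ i) - θ i| := Finset.abs_sum_le_sum_abs _ _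
    _ ≤ ∑ i, |θ i| ^ 3 := Finset.sum_le_sum fun i _ => abs_sin_sub_self_le (θ i)
    _ = ∑ i, |θ i| * θ i ^ 2 := Finset.sum_congr rfl fun i _ => by rw [← sq_abs (θ i)]; ring
    _ ≤ ∑ i, √(8 * g) * (8 * (1 - Real.cos (θ i))) :=
        Finset.sum_le_sum fun i _ =>
          mul_le_mul (habs i) (hterm i) (sq_nonneg _) (Real.sqrt_nonneg _)
    _ = 8 * √8 * (g * √g) := by
        rw [← Finset.mul_sum, ← Finset.mul_sum, Real.sqrt_mul (by norm_num : (0 : ℝ) ≤ 8) g]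
        ring

/-- **Small action forces small angles.** If `g = ∑ (1 - cos θ_i) < 1 - cos t` with `0 ≤ t` and all
`|θ_i| ≤ π`, then `|θ_i| < t` for every `i` (the cosine is decreasing on `[0, π]`). [folklore] -/
theorem abs_lt_of_sum_lt (θ : ι → ℝ) (hθ : ∀ i, |θ i| ≤ π) {t : ℝ} (ht : 0 ≤ t)
    (hlt : ∑ i, (1 - Real.cos (θ i)) < 1 - Real.cos t) (i : ι) : |θ i| < t := by
  by_contra h
  push Not at h
  have h1 : Real.cos |θ i| ≤ Real.cos t := Real.cos_le_cos_of_nonneg_of_le_pi ht (hθ i) h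
  rw [Real.cos_abs] at h1
  have h2 := one_sub_cos_le_sum θ i
  linarith

/-- **Small angles force winding number zero.** If `|θ_i| < t` with `#ι · t < 1` and `∑ θ_i = 2πk`
for an integer `k`, then `k = 0`. [folklore] -/
theorem int_eq_zero_of_abs_lt (θ : ι → ℝ) {t : ℝ} (hsmall : ∀ i, |θ i| < t)
    (hnt : (Fintype.card ι : ℝ) * t < 1) (k : ℤ) (hk : ∑ i, θ i = 2 * π * k) : k = 0 := by
  by_contra hk0
  have h1 : (1 : ℝ) ≤ |(k : ℝ)| := by
    rw [← Int.cast_abs]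
    exact_mod_cast Int.one_le_abs hk0
  have h2 : |∑ i, θ i| ≤ (Fintype.card ι : ℝ) * t :=
    calc |∑ i, θ i| ≤ ∑ i, |θ i| := Finset.abs_sum_le_sum_abs _ _
      _ ≤ ∑ _i : ι, t := Finset.sum_le_sum fun i _ => (hsmall i).le
      _ = (Fintype.card ι : ℝ) * t := by rw [Finset.sum_const, Finset.card_univ, nsmul_eq_mul]
  rw [hk, abs_mul, abs_mul, abs_of_pos Real.pi_pos, abs_two] at h2
  have h3 : (6 : ℝ) ≤ 2 * π * |(k : ℝ)| := by nlinarith [Real.pi_gt_three]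
  linarith

/-- **Real-variable core.** For angles `|θ_i| ≤ π` with `∑ θ_i ∈ 2πℤ`,
`|∑ sin θ_i| ≤ (n / (δ √δ) + 8 √8) · (∑ (1 - cos θ_i)) ^ (3/2)` where `n = #ι` and
`δ = 1 - cos (1/(n+1))`. Case split on `∑ (1 - cos θ_i) < δ` (then the winding number vanishes and the
zero-sum estimate applies) versus `≥ δ` (then the trivial bound `n` suffices). [folklore] -/
theorem abs_sum_sin_le (θ : ι → ℝ) (hθ : ∀ i, |θ i| ≤ π) (k : ℤ) (hk : ∑ i, θ i = 2 * π * k) :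
    |∑ i, Real.sin (θ i)| ≤
      ((Fintype.card ι : ℝ) / ((1 - Real.cos (1 / ((Fintype.card ι : ℝ) + 1))) *
          √(1 - Real.cos (1 / ((Fintype.card ι : ℝ) + 1)))) + 8 * √8) *
        (∑ i, (1 - Real.cos (θ i))) ^ ((3 : ℝ) / 2) := by
  set n : ℝ := (Fintype.card ι : ℝ)
  set t : ℝ := 1 / (n + 1) with ht
  set δ : ℝ := 1 - Real.cos t
  set g : ℝ := ∑ i, (1 - Real.cos (θ i))
  have hn0 : 0 ≤ n := Nat.cast_nonneg _
  have ht0 : 0 < t := by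
    rw [ht]
    exact div_pos one_pos (by linarith)
  have hnt : n * t < 1 := by
    rw [ht, mul_one_div, div_lt_one (by linarith)]
    linarith
  have hδ0 : 0 < δ := by
    have htπ : t ≤ π := by
      rw [ht, div_le_iff₀ (by linarith)]
      nlinarith [Real.pi_gt_three]
    have h : Real.cos t < Real.cos 0 := Real.cos_lt_cos_of_nonneg_of_le_pi le_rfl htπ ht0
    rw [Real.cos_zero] at h
    linarith
  have hg0 : 0 ≤ g := sum_one_sub_cos_nonneg θ
  rw [rpow_three_halves hg0]
  set A : ℝ := n / (δ * √δ)
  have hA0 : 0 ≤ A := div_nonneg hn0 (mul_nonneg hδ0.le (Real.sqrt_nonneg _))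
  have hX0 : 0 ≤ g * √g := mul_nonneg hg0 (Real.sqrt_nonneg _)
  rcases lt_or_ge g δ with hlt | hle
  · have hsmall : ∀ i, |θ i| < t := abs_lt_of_sum_lt θ hθ ht0.le hlt
    have hk0 : k = 0 := int_eq_zero_of_abs_lt θ hsmall hnt k hk
    have hsum : ∑ i, θ i = 0 := by rw [hk, hk0, Int.cast_zero, mul_zero]
    calc |∑ i, Real.sin (θ i)|
        ≤ 8 * √8 * (g * √g) := abs_sum_sin_le_of_sum_eq_zero θ hθ hsum
      _ ≤ (A + 8 * √8) * (g * √g) := by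
        rw [add_mul]
        exact le_add_of_nonneg_left (mul_nonneg hA0 hX0)
  · have hmono : δ * √δ ≤ g * √g :=
      mul_le_mul hle (Real.sqrt_le_sqrt hle) (Real.sqrt_nonneg _) hg0
    have hδδ : 0 < δ * √δ := mul_pos hδ0 (Real.sqrt_pos.2 hδ0)
    calc |∑ i, Real.sin (θ i)| ≤ n := abs_sum_sin_le_card θ
      _ = A * (δ * √δ) := (div_mul_cancel₀ n hδδ.ne').symm
      _ ≤ A * (g * √g) := mul_le_mul_of_nonneg_left hmono hA0
      _ ≤ (A + 8 * √8) * (g * √g) := by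
        rw [add_mul]
        exact le_add_of_nonneg_right
          (mul_nonneg (mul_nonneg (by norm_num) (Real.sqrt_nonneg _)) hX0)

/-! ### Unit complex numbers with product one -/

/-- **Complex wrapper.** For unit complex numbers `z_i` with `∏ z_i = 1`,
`|Im ∑ z_i| ≤ C(#ι) · (#ι - Re ∑ z_i) ^ (3/2)`: write `z_i = exp (i arg z_i)` and apply
`abs_sum_sin_le` to the arguments, whose sum lies in `2πℤ` because `exp (i ∑ arg z_i) = ∏ z_i = 1`.
[folklore] -/
theorem abs_im_sum_le (z : ι → ℂ) (hz : ∀ i, ‖z i‖ = 1) (hprod : ∏ i, z i = 1) :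
    |(∑ i, z i).im| ≤
      ((Fintype.card ι : ℝ) / ((1 - Real.cos (1 / ((Fintype.card ι : ℝ) + 1))) *
          √(1 - Real.cos (1 / ((Fintype.card ι : ℝ) + 1)))) + 8 * √8) *
        ((Fintype.card ι : ℝ) - (∑ i, z i).re) ^ ((3 : ℝ) / 2) := by
  set θ : ι → ℝ := fun i => Complex.arg (z i)
  have hzi : ∀ i, z i = Complex.exp (θ i * Complex.I) := fun i => by
    have h := Complex.norm_mul_exp_arg_mul_I (z i)
    rw [hz i, Complex.ofReal_one, one_mul] at h
    exact h.symm
  have him : (∑ i, z i).im = ∑ i, Real.sin (θ i) := by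
    rw [Complex.im_sum]
    exact Finset.sum_congr rfl fun i _ => by rw [hzi i, Complex.exp_ofReal_mul_I_im]
  have hre : (Fintype.card ι : ℝ) - (∑ i, z i).re = ∑ i, (1 - Real.cos (θ i)) := by
    rw [Complex.re_sum, Finset.sum_sub_distrib, Finset.sum_const, Finset.card_univ, nsmul_eq_mul,
      mul_one]
    congr 1
    exact Finset.sum_congr rfl fun i _ => by rw [hzi i, Complex.exp_ofReal_mul_I_re]
  have hexp : Complex.exp ((∑ i, θ i : ℝ) * Complex.I) = 1 := by
    rw [Complex.ofReal_sum, Finset.sum_mul, Complex.exp_sum, ← hprod]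
    exact Finset.prod_congr rfl fun i _ => (hzi i).symm
  obtain ⟨k, hk⟩ := Complex.exp_eq_one_iff.1 hexp
  have hsum : ∑ i, θ i = 2 * π * k := by
    have h2 : ((∑ i, θ i : ℝ) : ℂ) * Complex.I = ((2 * π * k : ℝ) : ℂ) * Complex.I := by
      rw [hk]
      push_cast
      ring
    exact_mod_cast mul_right_cancel₀ Complex.I_ne_zero h2
  rw [him, hre]
  exact abs_sum_sin_le θ (fun i => Complex.abs_arg_le_pi (z i)) k hsum

/-! ### Special unitary matrices -/

/-- The roots of the characteristic polynomial of a unitary matrix lie on the unit circle (they belong to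
the spectrum of a unitary element of the C⋆-algebra `M_N(ℂ)`). [folklore] -/
theorem norm_eq_one_of_mem_roots_charpoly {N : ℕ} {V : Matrix (Fin N) (Fin N) ℂ}
    (hV : V ∈ Matrix.unitaryGroup (Fin N) ℂ) {μ : ℂ} (hμ : μ ∈ V.charpoly.roots) :
    ‖μ‖ = 1 :=
  spectrum.norm_eq_one_of_unitary hV
    (Matrix.mem_spectrum_of_isRoot_charpoly (Polynomial.isRoot_of_mem_roots hμ))

/-- **Matrix form with the explicit constant.** For `V ∈ U(N)` with `det V = 1`,
`|Im tr V| ≤ (N / (δ √δ) + 8 √8) · (N - Re tr V) ^ (3/2)` with `δ = 1 - cos (1/(N+1))`: apply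
`abs_im_sum_le` to the family of roots of the characteristic polynomial (sum `tr V`, product `det V = 1`,
`N` of them, all of modulus one). [folklore] -/
theorem abs_trace_im_le {N : ℕ} (V : Matrix (Fin N) (Fin N) ℂ) (hV : V ∈ Matrix.unitaryGroup (Fin N) ℂ)
    (hdet : V.det = 1) :
    |V.trace.im| ≤
      ((N : ℝ) / ((1 - Real.cos (1 / ((N : ℝ) + 1))) * √(1 - Real.cos (1 / ((N : ℝ) + 1)))) +
          8 * √8) *
        ((N : ℝ) - V.trace.re) ^ ((3 : ℝ) / 2) := by
  classical
  set s : Multiset ℂ := V.charpoly.roots with hs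
  have hcard : Fintype.card s = N := by
    rw [Multiset.card_coe, hs, Polynomial.splits_iff_card_roots.1 (IsAlgClosed.splits V.charpoly),
      Matrix.charpoly_natDegree_eq_dim, Fintype.card_fin]
  have htr : V.trace = ∑ x : s, (x : ℂ) := by
    rw [Matrix.trace_eq_sum_roots_charpoly, ← Multiset.sum_eq_sum_coe]
  have hpr : ∏ x : s, (x : ℂ) = 1 := by
    rw [← Multiset.prod_eq_prod_coe, ← hdet, Matrix.det_eq_prod_roots_charpoly]
  have hnorm : ∀ x : s, ‖(x : ℂ)‖ = 1 := fun x =>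
    norm_eq_one_of_mem_roots_charpoly hV (Multiset.coe_mem (x := x))
  have h := abs_im_sum_le (fun x : s => (x : ℂ)) hnorm hpr
  rw [hcard] at h
  rw [htr]
  exact h

end OddTraceActionBound

/-- **Stub `stub_oddTraceActionBound`** (line `purity-rate-split`, crux stmt-QuantumFields-9442): for every
`N` there is a constant `C` such that every special unitary matrix `V ∈ SU(N)` satisfies
`|Im tr V| ≤ C · (N - Re tr V) ^ (3/2)` — the `C`-odd single-plaquette character is controlled
super-linearly by the Wilson action density, so no `U(1)`-type linear coupling to a massless mode survives.
An admissible constant is `C = N / (1 - cos (1/(N+1))) ^ (3/2) + 8 √8`. [folklore] -/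
theorem stub_oddTraceActionBound : ∀ N : ℕ, ∃ C : ℝ, ∀ V : Matrix (Fin N) (Fin N) ℂ, V ∈ Matrix.unitaryGroup (Fin N) ℂ → V.det = 1 → |V.trace.im| ≤ C * ((N : ℝ) - V.trace.re) ^ ((3 : ℝ) / 2) :=
  fun N =>
    ⟨(N : ℝ) / ((1 - Real.cos (1 / ((N : ℝ) + 1))) * √(1 - Real.cos (1 / ((N : ℝ) + 1)))) +
        8 * √8,
      fun V hV hdet => OddTraceActionBound.abs_trace_im_le V hV hdet⟩

end Summit.QuantumFields.YangMills.Theorems.FiniteSusceptibilityWeakCoupling
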